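import Literature.Topology.FourManifolds.FishtailBox
import Literature.Topology.FourManifolds.GompfTwistTransport
import HarnessLib

/-!
# The far box of Gompf's Theorem 2.1 in the product model: flat face on the fibre sliver

Layout of the box `N = D_N × T²` of R. Gompf, *More Cappell–Shaneson spheres are standard*, Algebr.
Geom. Topol. 10 (2010), proof of Thm 2.1 ("`N = I₀ × [0,1] × T² ⊂ I₀ × M`", regluing supported on
"the front face `∂₊I₀ × [0,1] × T²`") inside the straightened product model `prodSurgered ψ ε`
(`GompfFramedTwistTransport.lean`), where the regluing has to happen *exactly* across the fibre
sliver `{t = 1} × farSupport τ` of the second cylinder by Gompf's far Dehn twist `farDehn`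
(`GompfTwistTransport.lean`, `GompfProductTwist.lean`). The disc `D_N` lies in the `(t, y)`-plane
(`t ∈ (1/2, 3/2)` the base of the second cylinder, `y = arg z₂`), on the far side `y ≈ π`, with a
**flat face on the line `t = 1`** carrying both the hole (where Gompf's disc lands) and the band
(where the twist happens). We reuse the polar domain with flat top of `FishtailBox.lean`
(`boxR`, `boxY`, `boxS`), turned so that its flat top becomes the face `t = 1` and traversed with
`y` increasing in the model base `s` near the face (`thetaV`, the orientation forced by the
handle chart):

* `Literature.Topology.FourManifolds.faceT`, `Literature.Topology.FourManifolds.faceY` — the shell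
  point `(t, y) = (1 + h - (1-e) R(θ) sin θ, c_y + (1-e) R(θ) cos θ)` at angle `θ` and depth `e`,
  with constants `h = R₀ = 1/5`, `φ₁ = arctan 3`, `φ₂ = arctan 6`, `c_y = π - 1/4`; on the flat
  sector `t = 1 + e h` exactly and `y = c_y + (1-e) h tan(2π(s-1))` (`faceT_flat`, `faceY_flat_thetaV`);
  bounds `1 + e h ≤ t ≤ 7/5`, `|y - c_y| ≤ 5/4`; injectivity (`face_inj`); smoothness.
* `Literature.Topology.FourManifolds.kap0`, `Literature.Topology.FourManifolds.kapV` — the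
  **depth-dependent staircase** `κ(e, s)` whose full-turn twist `e^{2πiκ}` equals the far Dehn twist
  `e^{i farLift(y(e,s))}` at the corresponding point of the face (`circleExp_two_pi_mul_kap0`), with the
  stair law `κ(e, s+1) = κ(e, s) + 1` on `[0, 1/2]` (for `FishParamsD`, `FishtailEndModelDepth.lean`),
  for `τ = tauFar = 1/10`.

Everything is proved; no named facts.

## References

* R. E. Gompf, *More Cappell–Shaneson spheres are standard*, Algebr. Geom. Topol. 10 (2010)
  1665–1681, proof of Thm 2.1 (the box `N` and its front face) and Lemma 2.2. [GompfAGT2010]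
-/

noncomputable section

open scoped Real ContDiff Topology
open Set Function Filter

namespace Literature.Topology.FourManifolds

/-! ### Constants -/

section Constants

/-- Distance of the centre from the face, `h = 1/5`. [folklore] -/
def bxH : ℝ := 1 / 5

/-- Aperture of the flat sector, `φ₁ = arctan 3`. [folklore] -/
def bxPhi1 : ℝ := Real.arctan 3

/-- End of the blending zone, `φ₂ = arctan 6`. [folklore] -/
def bxPhi2 : ℝ := Real.arctan 6

/-- The margin `τ = 1/10` of Gompf's far Dehn twist used in the construction. [folklore] -/
def tauFar : ℝ := 1 / 10

/-- The height of the centre of the box (and of the hole), `c_y = π - 1/4`. [folklore] -/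
def cY : ℝ := π - 1 / 4

/-- `bxH_pos`. [folklore] -/
theorem bxH_pos : 0 < bxH := by unfold bxH; norm_num

/-- `bxPhi1_pos`. [folklore] -/
theorem bxPhi1_pos : 0 < bxPhi1 := by
  unfold bxPhi1; rw [← Real.arctan_zero]; exact Real.arctan_strictMono (by norm_num)

/-- `bxPhi1_lt_bxPhi2`. [folklore] -/
theorem bxPhi1_lt_bxPhi2 : bxPhi1 < bxPhi2 := Real.arctan_strictMono (by norm_num)

/-- `bxPhi2_lt`. [folklore] -/
theorem bxPhi2_lt : bxPhi2 < π / 2 := Real.arctan_lt_pi_div_two 6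

/-- `bxPhi1_nonneg`. [folklore] -/
theorem bxPhi1_nonneg : 0 ≤ bxPhi1 := bxPhi1_pos.le

/-- `tauFar_pos`. [folklore] -/
theorem tauFar_pos : 0 < tauFar := by unfold tauFar; norm_num

/-- `tauFar_lt`. [folklore] -/
theorem tauFar_lt : tauFar < π / 2 := by unfold tauFar; linarith [Real.pi_gt_three]

/-- `cos φ₂ = 1/√37`. [folklore] -/
theorem cos_bxPhi2 : Real.cos bxPhi2 = 1 / Real.sqrt 37 := by
  rw [bxPhi2, Real.cos_arctan]; norm_num

/-- `tan φ₁ = 3`. [folklore] -/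
theorem tan_bxPhi1 : Real.tan bxPhi1 = 3 := Real.tan_arctan 3

end Constants

/-! ### The angle about the centre, with `y` increasing in `s` near the face -/

section Angle

/-- **The angle about the centre of the box**: `θ_V(s) = π/2 - 2π(s - 1)` (the seam `s ≡ 1` is the
centre of the face; `y` increases with `s` there). [folklore] -/
def thetaV (s : ℝ) : ℝ := π / 2 - 2 * π * (s - 1)

/-- `contDiff_thetaV`. [folklore] -/
theorem contDiff_thetaV : ContDiff ℝ ∞ thetaV :=
  contDiff_const.sub (contDiff_const.mul (contDiff_id.sub contDiff_const))

/-- `thetaV_one`. [folklore] -/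
@[simp] theorem thetaV_one : thetaV 1 = π / 2 := by simp [thetaV]

/-- `sin_thetaV`. [folklore] -/
theorem sin_thetaV (s : ℝ) : Real.sin (thetaV s) = Real.cos (2 * π * (s - 1)) := by
  rw [thetaV, Real.sin_pi_div_two_sub]

/-- `cos_thetaV`. [folklore] -/
theorem cos_thetaV (s : ℝ) : Real.cos (thetaV s) = Real.sin (2 * π * (s - 1)) := by
  rw [thetaV, Real.cos_pi_div_two_sub]

/-- `abs_thetaV_sub`. [folklore] -/
theorem abs_thetaV_sub (s : ℝ) : |thetaV s - π / 2| = 2 * π * |s - 1| := by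
  rw [thetaV, show π / 2 - 2 * π * (s - 1) - π / 2 = -(2 * π * (s - 1)) by ring, abs_neg, abs_mul,
    abs_of_pos (by positivity : (0 : ℝ) < 2 * π)]

/-- `θ_V(s + 1) = θ_V(s) - 2π`. [folklore] -/
theorem thetaV_add_one (s : ℝ) : thetaV (s + 1) = thetaV s - 2 * π := by unfold thetaV; ring

/-- **The flat-sector criterion read on the base**: `|s - 1| < 1/4` and `|tan(2π(s-1))| ≤ 3` give
`|θ_V(s) - π/2| ≤ φ₁`. [folklore] -/
theorem abs_thetaV_sub_le {s : ℝ} (hs : |s - 1| < 1 / 4) (ht : |Real.tan (2 * π * (s - 1))| ≤ 3) :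
    |thetaV s - π / 2| ≤ bxPhi1 := by
  have hπ := Real.pi_pos
  have hlt : |2 * π * (s - 1)| < π / 2 := by
    rw [abs_mul, abs_of_pos (by positivity : (0 : ℝ) < 2 * π)]
    have := abs_nonneg (s - 1); nlinarith
  have hx := abs_lt.1 hlt
  rw [abs_thetaV_sub, ← abs_of_pos (by positivity : (0 : ℝ) < 2 * π), ← abs_mul, bxPhi1]
  rcases le_or_gt 0 (2 * π * (s - 1)) with h0 | h0
  · rw [abs_of_nonneg h0, ← Real.arctan_tan hx.1 hx.2]
    exact Real.arctan_mono ((le_abs_self _).trans ht)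
  · rw [abs_of_neg h0, ← Real.arctan_tan (x := -(2 * π * (s - 1))) (by linarith) (by linarith),
      Real.tan_neg]
    exact Real.arctan_mono ((neg_le_abs _).trans ht)

end Angle

/-! ### The shell of the box in the `(t, y)`-plane -/

section Shell

/-- The radius profile of the far box. [folklore] -/
abbrev bxR (θ : ℝ) : ℝ := boxR bxH bxH bxPhi1 bxPhi2 θ

/-- **The base coordinate of the shell point**: `t = 1 + h - (1 - e) R(θ) sin θ`. [cite: GompfAGT2010, Thm 2.1 (proof: the front face ∂₊I₀ × [0,1] × T²)] -/
def faceT (θ e : ℝ) : ℝ := 1 + bxH - (1 - e) * bxR θ * Real.sin θ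

/-- **The height of the shell point**: `y = c_y + (1 - e) R(θ) cos θ`. [folklore] -/
def faceY (θ e : ℝ) : ℝ := cY + (1 - e) * bxR θ * Real.cos θ

/-- Relation to `boxY` of `FishtailBox.lean`. [folklore] -/
theorem faceT_eq (θ e : ℝ) : faceT θ e = 2 - boxY 1 bxH bxH bxPhi1 bxPhi2 θ e := by
  rw [faceT, boxY]; ring

/-- Relation to `boxS` of `FishtailBox.lean`. [folklore] -/
theorem faceY_eq (θ e : ℝ) : faceY θ e = cY - 3 / 4 + boxS bxH bxH bxPhi1 bxPhi2 θ e := by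
  rw [faceY, boxS]; ring

/-- **Flat face**: on the flat sector `t = 1 + e h`. [cite: GompfAGT2010, Thm 2.1 (proof: cut along the front face and reglue)] -/
theorem faceT_flat {θ : ℝ} (hθ : |θ - π / 2| ≤ bxPhi1) (e : ℝ) : faceT θ e = 1 + e * bxH := by
  rw [faceT_eq, boxY_flat bxPhi1_nonneg bxPhi1_lt_bxPhi2 bxPhi2_lt hθ]; ring

/-- On the flat sector `y = c_y + (1 - e) h cos θ / sin θ`. [folklore] -/
theorem faceY_flat {θ : ℝ} (hθ : |θ - π / 2| ≤ bxPhi1) (e : ℝ) :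
    faceY θ e = cY + (1 - e) * bxH * (Real.cos θ / Real.sin θ) := by
  rw [faceY_eq, boxS_flat bxPhi1_nonneg bxPhi1_lt_bxPhi2 bxPhi2_lt hθ]; ring

/-- **The face read from the base**: `y = c_y + (1 - e) h tan(2π(s - 1))` on the flat sector. [folklore] -/
theorem faceY_flat_thetaV {s : ℝ} (hθ : |thetaV s - π / 2| ≤ bxPhi1) (e : ℝ) :
    faceY (thetaV s) e = cY + (1 - e) * bxH * Real.tan (2 * π * (s - 1)) := by
  rw [faceY_flat hθ, sin_thetaV, cos_thetaV, Real.tan_eq_sin_div_cos]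

/-- The shell coordinates are smooth in `(θ, e)`. [folklore] -/
theorem contDiff_faceTY : ContDiff ℝ ∞ fun p : ℝ × ℝ ↦ (faceT p.1 p.2, faceY p.1 p.2) := by
  have h := contDiff_boxYS (ystar := 1) (h := bxH) (R₀ := bxH) bxPhi1_nonneg bxPhi1_lt_bxPhi2 bxPhi2_lt
  have h1 : ContDiff ℝ ∞ fun p : ℝ × ℝ ↦ boxY 1 bxH bxH bxPhi1 bxPhi2 p.1 p.2 := contDiff_fst.comp h
  have h2 : ContDiff ℝ ∞ fun p : ℝ × ℝ ↦ boxS bxH bxH bxPhi1 bxPhi2 p.1 p.2 := contDiff_snd.comp h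
  simp_rw [faceT_eq, faceY_eq]
  exact (contDiff_const.sub h1).prodMk (contDiff_const.add h2)

/-- **Injectivity of the shell**: equal shell points with depths `< 1` have equal depth and equal
direction. [folklore] -/
theorem face_inj {θ θ' e e' : ℝ} (he : e < 1) (he' : e' < 1) (hT : faceT θ e = faceT θ' e')
    (hY : faceY θ e = faceY θ' e') : e = e' ∧ Real.cos θ = Real.cos θ' ∧ Real.sin θ = Real.sin θ' := by
  refine boxYS_inj (ystar := 1) bxH_pos bxH_pos bxPhi1_nonneg bxPhi1_lt_bxPhi2 bxPhi2_lt he he' ?_ ?_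
  · rw [faceT_eq, faceT_eq] at hT; linarith
  · rw [faceY_eq, faceY_eq] at hY; linarith

/-- Where the bump is positive, `sin θ > cos φ₂`. [folklore] -/
theorem bxPhi2_le_pi : bxPhi2 ≤ π := bxPhi2_lt.le.trans (by linarith [Real.pi_pos])

/-- `cos_bxPhi2_pos`. [folklore] -/
theorem cos_bxPhi2_pos : 0 < Real.cos bxPhi2 :=
  Real.cos_pos_of_mem_Ioo ⟨by linarith [bxPhi1_pos, bxPhi1_lt_bxPhi2, Real.pi_pos], bxPhi2_lt⟩

/-- `cos_bxPhi2_lt_sin_of_topBump_ne`. [folklore] -/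
theorem cos_bxPhi2_lt_sin_of_topBump_ne {θ : ℝ} (h : topBump bxPhi1 bxPhi2 θ ≠ 0) : Real.cos bxPhi2 < Real.sin θ := by
  by_contra hle
  exact h (topBump_eq_zero bxPhi1_nonneg bxPhi1_lt_bxPhi2 bxPhi2_le_pi (not_lt.1 hle))

/-- **`R(θ) sin θ ≤ h`** (the box stays on the side `t ≥ 1` of the face). [folklore] -/
theorem bxR_mul_sin_le (θ : ℝ) : bxR θ * Real.sin θ ≤ bxH := by
  have hb := topBump_mem bxPhi1 bxPhi2 θ
  by_cases h0 : topBump bxPhi1 bxPhi2 θ = 0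
  · rw [bxR, boxR, h0]
    have := Real.sin_le_one θ
    have := bxH_pos
    nlinarith
  · have hs : 0 < Real.sin θ := by
      have := cos_bxPhi2_lt_sin_of_topBump_ne h0
      linarith [cos_bxPhi2_pos]
    rw [bxR, boxR, add_mul, mul_assoc, div_mul_cancel₀ _ hs.ne']
    have h1 : (1 - topBump bxPhi1 bxPhi2 θ) * bxH * Real.sin θ ≤ (1 - topBump bxPhi1 bxPhi2 θ) * bxH * 1 :=
      mul_le_mul_of_nonneg_left (Real.sin_le_one θ) (mul_nonneg (by linarith [hb.2]) bxH_pos.le)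
    linarith

/-- **`R(θ) ≤ 5/4`.** [folklore] -/
theorem bxR_le (θ : ℝ) : bxR θ ≤ 5 / 4 := by
  have hb := topBump_mem bxPhi1 bxPhi2 θ
  have hH : bxH = 1 / 5 := rfl
  by_cases h0 : topBump bxPhi1 bxPhi2 θ = 0
  · rw [bxR, boxR, h0, hH]; norm_num
  · have hs : Real.cos bxPhi2 < Real.sin θ := cos_bxPhi2_lt_sin_of_topBump_ne h0
    rw [cos_bxPhi2] at hs
    have h37 : 0 < Real.sqrt 37 := Real.sqrt_pos.2 (by norm_num)
    have hsq : Real.sqrt 37 < 25 / 4 := by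
      rw [Real.sqrt_lt' (by norm_num)]; norm_num
    have hspos : 0 < Real.sin θ := lt_trans (by positivity) hs
    have h1 : bxH / Real.sin θ ≤ 5 / 4 := by
      rw [div_le_iff₀ hspos, hH]
      have : 1 / Real.sqrt 37 * (25 / 4) > 1 / Real.sqrt 37 * Real.sqrt 37 := by gcongr
      rw [one_div_mul_cancel h37.ne'] at this
      nlinarith
    rw [bxR, boxR, hH] at *
    nlinarith [hb.1, hb.2]

/-- `0 < R(θ)`. [folklore] -/
theorem bxR_pos (θ : ℝ) : 0 < bxR θ := boxR_pos bxH_pos bxH_pos bxPhi1_nonneg bxPhi1_lt_bxPhi2 bxPhi2_lt θ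

/-- **`1 + e h ≤ t`** for `e ≤ 1`. [folklore] -/
theorem faceT_ge {θ e : ℝ} (he : e ≤ 1) : 1 + e * bxH ≤ faceT θ e := by
  have h := bxR_mul_sin_le θ
  rw [faceT]
  nlinarith

/-- **`t ≤ 7/5`** for `0 ≤ e ≤ 1`. [folklore] -/
theorem faceT_le {θ e : ℝ} (he0 : 0 ≤ e) (he : e ≤ 1) : faceT θ e ≤ 7 / 5 := by
  have hH : bxH = 1 / 5 := rfl
  rw [faceT]
  have hb := topBump_mem bxPhi1 bxPhi2 θ
  by_cases h0 : topBump bxPhi1 bxPhi2 θ = 0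
  · have hR : bxR θ = bxH := by rw [bxR, boxR, h0]; ring
    rw [hR, hH]
    have := Real.neg_one_le_sin θ
    nlinarith
  · have hs : 0 < Real.sin θ := by
      have := cos_bxPhi2_lt_sin_of_topBump_ne h0
      linarith [cos_bxPhi2_pos]
    have : 0 ≤ (1 - e) * bxR θ * Real.sin θ := by
      have := bxR_pos θ; positivity
    rw [hH]
    linarith

/-- **`|y - c_y| ≤ 5/4`** for `0 ≤ e ≤ 1`. [folklore] -/
theorem abs_faceY_sub_le {θ e : ℝ} (he0 : 0 ≤ e) (he : e ≤ 1) : |faceY θ e - cY| ≤ 5 / 4 := by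
  rw [faceY, add_sub_cancel_left, abs_mul, abs_mul, abs_of_nonneg (by linarith : (0 : ℝ) ≤ 1 - e),
    abs_of_pos (bxR_pos θ)]
  have h1 : (1 - e) * bxR θ ≤ 1 * (5 / 4) :=
    mul_le_mul (by linarith) (bxR_le θ) (bxR_pos θ).le zero_le_one
  have h2 := Real.abs_cos_le_one θ
  have h3 : 0 ≤ (1 - e) * bxR θ := by have := bxR_pos θ; positivity
  nlinarith

/-- **The box stays in the far half**: `1 < y < 6` for `0 ≤ e ≤ 1` (so it misses the tube
about `α ⊂ {y = 0}` and the surgery ball). [folklore] -/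
theorem faceY_mem {θ e : ℝ} (he0 : 0 ≤ e) (he : e ≤ 1) : 1 < faceY θ e ∧ faceY θ e < 6 := by
  have h := abs_le.1 (abs_faceY_sub_le (θ := θ) he0 he)
  have hπ := Real.pi_gt_three
  have hπ' := Real.pi_lt_four
  unfold cY at h
  constructor <;> linarith [h.1, h.2]

end Shell

/-! ### The depth-dependent staircase matched to the far Dehn twist -/

section Stair

/-- The height of the face point over `σ = s - 1` at depth `e`: `y(e, σ) = c_y + (1 - e) h tan(2πσ)`. [folklore] -/
def faceYs (e σ : ℝ) : ℝ := cY + (1 - e) * bxH * Real.tan (2 * π * σ)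

/-- On the flat sector the face height is `faceYs`. [folklore] -/
theorem faceY_thetaV_eq_faceYs {s : ℝ} (hθ : |thetaV s - π / 2| ≤ bxPhi1) (e : ℝ) :
    faceY (thetaV s) e = faceYs e (s - 1) :=
  faceY_flat_thetaV hθ e

/-- Lower plateau threshold `σ_lo = arctan(3/4)/(2π)` (`y(0, σ_lo) = π - τ`). [folklore] -/
def sigLo : ℝ := Real.arctan (3 / 4) / (2 * π)

/-- Upper plateau threshold `σ_hi = arctan(11/4)/(2π)` (`y(1/2, σ_hi) = π + τ/4`). [folklore] -/
def sigHi : ℝ := Real.arctan (11 / 4) / (2 * π)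

/-- `two_pi_mul_sigLo`. [folklore] -/
theorem two_pi_mul_sigLo : 2 * π * sigLo = Real.arctan (3 / 4) := by
  unfold sigLo; field_simp

/-- `two_pi_mul_sigHi`. [folklore] -/
theorem two_pi_mul_sigHi : 2 * π * sigHi = Real.arctan (11 / 4) := by
  unfold sigHi; field_simp

/-- `sigLo_pos`. [folklore] -/
theorem sigLo_pos : 0 < sigLo := by
  unfold sigLo
  have : 0 < Real.arctan (3 / 4) := by rw [← Real.arctan_zero]; exact Real.arctan_strictMono (by norm_num)
  positivity

/-- `sigLo_lt_sigHi`. [folklore] -/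
theorem sigLo_lt_sigHi : sigLo < sigHi := by
  unfold sigLo sigHi
  exact div_lt_div_of_pos_right (Real.arctan_strictMono (by norm_num)) (by positivity)

/-- `σ_hi < arctan 3 / (2π) < 1/4` (inside the flat sector). [folklore] -/
theorem sigHi_lt : 2 * π * sigHi < bxPhi1 := by
  rw [two_pi_mul_sigHi]; exact Real.arctan_strictMono (by norm_num)

/-- `sigHi_lt_quarter`. [folklore] -/
theorem sigHi_lt_quarter : sigHi < 1 / 4 := by
  have h := sigHi_lt
  have h2 : bxPhi1 < π / 2 := bxPhi1_lt_bxPhi2.trans bxPhi2_lt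
  have hπ := Real.pi_pos
  nlinarith

/-- `tan(2π σ_lo) = 3/4`, `tan(2π σ_hi) = 11/4`. [folklore] -/
theorem tan_sigLo : Real.tan (2 * π * sigLo) = 3 / 4 := by rw [two_pi_mul_sigLo, Real.tan_arctan]
/-- `tan_sigHi`. [folklore] -/
theorem tan_sigHi : Real.tan (2 * π * sigHi) = 11 / 4 := by rw [two_pi_mul_sigHi, Real.tan_arctan]

/-- The argument of the smooth transition in the staircase. [folklore] -/
def kapArg (e σ : ℝ) : ℝ := (faceYs e σ - (π - tauFar)) / (5 * tauFar / 4)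

/-- **The staircase on one period**: `0` for `σ ≤ σ_lo`, `1` for `σ ≥ σ_hi`, and
`S((y(e,σ) - (π - τ))/(5τ/4))` in between — the far lift `farLift τ` read at the face point,
divided by `2π`. [cite: GompfAGT2010, Thm 2.1 (proof: reglue the front face by the Dehn twist)] -/
def kap0 (e σ : ℝ) : ℝ :=
  if σ ≤ sigLo then 0 else if sigHi ≤ σ then 1 else Real.smoothTransition (kapArg e σ)

/-- Monotonicity of `tan (2π ·)` on `(-1/4, 1/4)`. [folklore] -/
theorem tan_two_pi_mul_lt_tan {a b : ℝ} (ha : -(1 / 4) < a) (hab : a < b) (hb : b < 1 / 4) :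
    Real.tan (2 * π * a) < Real.tan (2 * π * b) := by
  have hπ := Real.pi_pos
  exact Real.tan_lt_tan_of_lt_of_lt_pi_div_two (by nlinarith) (by nlinarith) (by nlinarith)

/-- Below `σ_lo` (and above `-1/4`) the argument is nonpositive, for `0 ≤ e ≤ 1`. [folklore] -/
theorem kapArg_nonpos {e σ : ℝ} (he0 : 0 ≤ e) (he : e ≤ 1) (hσ : -(1 / 4) < σ) (hσ' : σ ≤ sigLo) :
    kapArg e σ ≤ 0 := by
  have hτ : tauFar = 1 / 10 := rfl
  have hH : bxH = 1 / 5 := rfl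
  have ht : Real.tan (2 * π * σ) ≤ 3 / 4 := by
    rcases hσ'.lt_or_eq with hlt | heq
    · exact (tan_two_pi_mul_lt_tan hσ hlt (sigLo_lt_sigHi.trans sigHi_lt_quarter)).le.trans tan_sigLo.le
    · rw [heq, tan_sigLo]
  unfold kapArg faceYs cY
  rw [hτ, hH, div_nonpos_iff]
  refine Or.inr ⟨?_, by norm_num⟩
  rcases le_or_gt 0 (Real.tan (2 * π * σ)) with h0 | h0
  · nlinarith
  · nlinarith

/-- Above `σ_hi` (and below `1/4`) the argument is at least `1`, for `0 ≤ e ≤ 1/2`. [folklore] -/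
theorem one_le_kapArg {e σ : ℝ} (he : e ≤ 1 / 2) (hσ : sigHi ≤ σ) (hσ' : σ < 1 / 4) :
    1 ≤ kapArg e σ := by
  have hτ : tauFar = 1 / 10 := rfl
  have hH : bxH = 1 / 5 := rfl
  have ht : 11 / 4 ≤ Real.tan (2 * π * σ) := by
    rcases hσ.lt_or_eq with hlt | heq
    · exact tan_sigHi.symm.le.trans (tan_two_pi_mul_lt_tan (by linarith [sigLo_pos, sigLo_lt_sigHi]) hlt hσ').le
    · rw [← heq, tan_sigHi]
  unfold kapArg faceYs cY
  rw [hτ, hH, le_div_iff₀ (by norm_num)]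
  nlinarith

/-- **On `0 ≤ e ≤ 1/2`, `-1/4 < σ < 1/4` the staircase is the smooth transition of the argument**
(the plateaus are where the transition saturates). [folklore] -/
theorem kap0_eq {e σ : ℝ} (he0 : 0 ≤ e) (he : e ≤ 1 / 2) (hσ : -(1 / 4) < σ) (hσ' : σ < 1 / 4) :
    kap0 e σ = Real.smoothTransition (kapArg e σ) := by
  unfold kap0
  split_ifs with h1 h2
  · rw [Real.smoothTransition.zero_of_nonpos (kapArg_nonpos he0 (by linarith) hσ h1)]
  · rw [Real.smoothTransition.one_of_one_le (one_le_kapArg he h2 hσ')]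
  · rfl

/-- The staircase is `0` below `σ_lo`. [folklore] -/
theorem kap0_of_le {e σ : ℝ} (h : σ ≤ sigLo) : kap0 e σ = 0 := by rw [kap0, if_pos h]

/-- The staircase is `1` above `σ_hi`. [folklore] -/
theorem kap0_of_ge {e σ : ℝ} (h : sigHi ≤ σ) : kap0 e σ = 1 := by
  rw [kap0, if_neg (not_le.2 (sigLo_lt_sigHi.trans_le h)), if_pos h]

/-- The argument is smooth in `(e, σ)` on `|σ| < 1/4`. [folklore] -/
theorem contDiffAt_kapArg {p : ℝ × ℝ} (hσ : -(1 / 4) < p.2) (hσ' : p.2 < 1 / 4) :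
    ContDiffAt ℝ ∞ (fun q : ℝ × ℝ ↦ kapArg q.1 q.2) p := by
  have hπ := Real.pi_pos
  have hcos : Real.cos (2 * π * p.2) ≠ 0 :=
    (Real.cos_pos_of_mem_Ioo ⟨by nlinarith, by nlinarith⟩).ne'
  have ht : ContDiffAt ℝ ∞ (fun q : ℝ × ℝ ↦ Real.tan (2 * π * q.2)) p :=
    ContDiffAt.comp (g := Real.tan) (f := fun q : ℝ × ℝ ↦ 2 * π * q.2) p (Real.contDiffAt_tan.2 hcos)
      (contDiffAt_const.mul contDiffAt_snd)
  unfold kapArg faceYs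
  exact ((contDiffAt_const.add (((contDiffAt_const.sub contDiffAt_fst).mul contDiffAt_const).mul ht)).sub
    contDiffAt_const).div_const _

/-- **The staircase is jointly smooth on `(-1, 1/2+) × ℝ`**: near `|σ| < 1/4` it is the smooth
transition of the argument, elsewhere locally constant. We state it on the open set
`{e < 1/2 + 0} ∩ {0 - 0 < e}`… precisely at every point with `0 < e < 1/2` (enough for the
depths used) and also for `e` in a neighbourhood of `[0, 1/2]` via the clamp below. [folklore] -/
theorem contDiffAt_kap0 {p : ℝ × ℝ} (he0 : 0 < p.1) (he : p.1 < 1 / 2) :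
    ContDiffAt ℝ ∞ (fun q : ℝ × ℝ ↦ kap0 q.1 q.2) p := by
  rcases lt_or_ge p.2 sigLo with hlo | hlo
  · -- locally `0`
    have hev : (fun q : ℝ × ℝ ↦ kap0 q.1 q.2) =ᶠ[𝓝 p] fun _ ↦ 0 := by
      filter_upwards [(isOpen_lt continuous_snd continuous_const).mem_nhds hlo] with q hq
      exact kap0_of_le hq.le
    exact contDiffAt_const.congr_of_eventuallyEq hev
  rcases lt_or_ge sigHi p.2 with hhi | hhi
  · have hev : (fun q : ℝ × ℝ ↦ kap0 q.1 q.2) =ᶠ[𝓝 p] fun _ ↦ 1 := by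
      filter_upwards [(isOpen_lt continuous_const continuous_snd).mem_nhds hhi] with q hq
      exact kap0_of_ge hq.le
    exact contDiffAt_const.congr_of_eventuallyEq hev
  · -- `σ_lo ≤ σ ≤ σ_hi`: locally the smooth transition of the argument
    have hq : -(1 / 4) < p.2 := by linarith [sigLo_pos]
    have hq' : p.2 < 1 / 4 := hhi.trans_lt sigHi_lt_quarter
    have hev : (fun q : ℝ × ℝ ↦ kap0 q.1 q.2) =ᶠ[𝓝 p] fun q ↦ Real.smoothTransition (kapArg q.1 q.2) := by
      have ho : IsOpen {q : ℝ × ℝ | 0 < q.1 ∧ q.1 < 1 / 2 ∧ -(1 / 4) < q.2 ∧ q.2 < 1 / 4} := by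
        refine ((isOpen_lt continuous_const continuous_fst).inter ((isOpen_lt continuous_fst continuous_const).inter
          ((isOpen_lt continuous_const continuous_snd).inter (isOpen_lt continuous_snd continuous_const))))
      filter_upwards [ho.mem_nhds ⟨he0, he, hq, hq'⟩] with q hq
      exact kap0_eq hq.1.le hq.2.1.le hq.2.2.1 hq.2.2.2
    exact (Real.smoothTransition.contDiff.contDiffAt.comp p (contDiffAt_kapArg hq hq')).congr_of_eventuallyEq hev

/-- **The full staircase** `κ(e, s) = κ₀(e, s) + κ₀(e, s - 1)`: steps at `s - 1 ∈ (σ_lo, σ_hi)`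
in the second cylinder and its copy one turn earlier. [folklore] -/
def kapV (e s : ℝ) : ℝ := kap0 e s + kap0 e (s - 1)

/-- **The stair law** `κ(e, s + 1) = κ(e, s) + 1` for `0 ≤ s ≤ 1/2`. [folklore] -/
theorem kapV_add_one (e : ℝ) {s : ℝ} (hs0 : 0 ≤ s) (hs : s ≤ 1 / 2) : kapV e (s + 1) = kapV e s + 1 := by
  have h1 : kap0 e (s + 1) = 1 := kap0_of_ge (by linarith [sigHi_lt_quarter])
  have h2 : kap0 e (s - 1) = 0 := kap0_of_le (by linarith [sigLo_pos])
  rw [kapV, kapV, h1, add_sub_cancel_right, h2]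
  ring

/-- In the band of the second cylinder `κ(e, s) = 1 + κ₀(e, s - 1)` (`s ≥ 1/2 + σ_hi`…, precisely
for `sigHi ≤ s`). [folklore] -/
theorem kapV_of_ge (e : ℝ) {s : ℝ} (hs : sigHi ≤ s) : kapV e s = 1 + kap0 e (s - 1) := by
  rw [kapV, kap0_of_ge hs]

/-- The full staircase is smooth at every `(e, s)` with `0 < e < 1/2`. [folklore] -/
theorem contDiffAt_kapV {p : ℝ × ℝ} (he0 : 0 < p.1) (he : p.1 < 1 / 2) :
    ContDiffAt ℝ ∞ (fun q : ℝ × ℝ ↦ kapV q.1 q.2) p := by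
  have h1 := contDiffAt_kap0 (p := p) he0 he
  have h2 : ContDiffAt ℝ ∞ (fun q : ℝ × ℝ ↦ kap0 q.1 (q.2 - 1)) p :=
    (contDiffAt_kap0 (p := (p.1, p.2 - 1)) he0 he).comp p (contDiffAt_fst.prodMk (contDiffAt_snd.sub contDiffAt_const))
  exact h1.add h2

/-! #### The full-turn twist is the far Dehn twist at the face point -/

/-- **`e^{2πi κ₀(e,σ)} = F_τ(e^{i y(e,σ)})`**, `F_τ = circleMapOfLift (farLift τ)` the circle map
of Gompf's far Dehn twist, for `0 ≤ e ≤ 1/2`, `0 ≤ σ < 1/4` and `y(e, σ) ≤ 2π` (the face and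
beyond, on the side of the band). [cite: GompfAGT2010, Thm 2.1 (proof: reglue by the given Dehn twist)] -/
theorem circleExp_two_pi_mul_kap0 {e σ : ℝ} (he0 : 0 ≤ e) (he : e ≤ 1 / 2) (hσ : 0 ≤ σ) (hσ' : σ < 1 / 4)
    (hy : faceYs e σ ≤ 2 * π) :
    Circle.exp (2 * π * kap0 e σ) = circleMapOfLift (farLift tauFar) (Circle.exp (faceYs e σ)) := by
  have hτ : tauFar = 1 / 10 := rfl
  have hH : bxH = 1 / 5 := rfl
  have hπ := Real.pi_gt_three
  have hπ' := Real.pi_lt_four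
  rw [circleMapOfLift_exp (k := 1) (farLift_periodic tauFar), kap0_eq he0 he (by linarith) hσ']
  set y := faceYs e σ with hydef
  -- `y ≥ c_y`
  have htan : 0 ≤ Real.tan (2 * π * σ) := by
    rcases hσ.eq_or_lt with h0 | h0
    · rw [← h0, mul_zero, Real.tan_zero]
    · exact (Real.tan_pos_of_pos_of_lt_pi_div_two (by positivity) (by nlinarith [Real.pi_pos])).le
  have hy0 : π - 1 / 4 ≤ y := by
    rw [hydef, faceYs, hH, cY]
    nlinarith
  -- the far lift at `y`
  have hfar : farLift tauFar y = gompfLift (π - 3 * tauFar / 2) (π - tauFar / 4) (y - tauFar / 2) := rfl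
  rcases le_or_gt (y - tauFar / 2) π with hle | hgt
  · -- principal domain: the far lift is `2π S(kapArg)`
    have hk : (y - tauFar / 2 - (π - 3 * tauFar / 2)) / (π - tauFar / 4 - (π - 3 * tauFar / 2)) = kapArg e σ := by
      rw [kapArg, ← hydef, hτ]
      field_simp
      ring
    rw [hfar, gompfLift_eq_of_mem_Ioc _ _ ⟨by rw [hτ]; linarith, hle⟩, hk]
  · -- beyond `π + τ/2`: both sides are a full turn
    have h1 : 1 ≤ kapArg e σ := by
      rw [kapArg, hτ, le_div_iff₀ (by norm_num)]
      rw [hτ] at hgt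
      linarith
    have h2 : gompfLift (π - 3 * tauFar / 2) (π - tauFar / 4) (y - tauFar / 2) = 2 * π := by
      have h := gompfLift_add_two_pi (π - 3 * tauFar / 2) (π - tauFar / 4) (y - tauFar / 2 - 2 * π)
      rw [sub_add_cancel] at h
      rw [h, gompfLift_eq_zero (by rw [hτ]; linarith) (by rw [hτ]; linarith) (by linarith)
        (by rw [hτ] at hgt ⊢; linarith), zero_add]
    rw [Real.smoothTransition.one_of_one_le h1, mul_one, hfar, h2]

end Stair

end Literature.Topology.FourManifolds
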